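import Mathlib
import HarnessLib
import Summits.HubbardSuperconductivity.HubbardSuperconductivity.Theorems.KLProgrammeKLRegimeSplitTwoLegMomentsFromPosition
import Summits.HubbardSuperconductivity.HubbardSuperconductivity.Theorems.KLProgrammeKLRegimeSplitSymInterpPureMoments

/-!
# Route `KLProgramme` — ENGINE child 19918, stub `stub_twoLeg_scale0`: the (M1) Fourier bridge for an ARBITRARY EVEN WEIGHT, hence for the
# spatially OFF-DIAGONAL moments, and the K-separated scale-`0` data `g = klLocSelfEnergyRe … K 0 − K∘p`

Cell `gate-hubbard-kl`, seat p1b (g7).  Companion of `…TwoLegScaleZeroSizesSep` (the K-separated (E3a) tier-1 sizes at scale `0`, hypotheses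
`mₖ ≥ ‖Dᵏ evalM (symInterp L g)‖`, `k ≤ 2`).  The tree bridge `sum_weight_abs_torusCosCoeff_re_selfEnergy_le` (p485541) reads the weight
`(1 + |z̃₀| + |z̃₁|)ʲ`; its proof uses only that the weight is NONNEGATIVE and EVEN on the torus, so:

* **`sum_evenWeight_abs_torusCosCoeff_re_selfEnergy_le`** (generic `G`, kept frequency, spin; any even weight `w ≥ 0`):
  `Σ_y w(y)·|torusCosCoeff L (k⃗ ↦ Re Σ_G((ω,k⃗),σ)) y| ≤ 2·M` whenever `ε_x Σ_{x : x 0 = x₀} w(x⃗₁ − x⃗₀)·‖W_σ(G)(x)‖ ≤ M` for every `x₀`;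
* **`sum_offDiag_weight_abs_torusCosCoeff_locRe_le`** (generic `G`): the OFF-ZERO coefficient moments of the localised two-leg data
  `loc(G) = ¼Σ_σ[Re Σ_G((ω₀,·),σ) + Re Σ_G((−ω₀,·),σ)]` from the OFF-DIAGONAL pinned position moments
  `ε_x Σ_{x : x 0 = x₀, x⃗₁ ≠ x⃗₀} (1+|Δx̃₀|+|Δx̃₁|)ʲ ‖W_σ(G)(x)‖ ≤ Mˢ♯ⱼ` (both spin strings): `Σ_{y ≠ 0} (1+|ỹ₀|+|ỹ₁|)ʲ |loc(G)_c(y)| ≤ 2Mˢ♯ⱼ`;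
* **`norm_iteratedFDeriv_evalM_symInterp_locRe_le_offDiag`**: hence `‖Dᵏ evalM (symInterp L loc(G))‖ ≤ 2Mˢ♯ₖ` for `1 ≤ k` — the spatially
  LOCAL part of the two-leg kernel (the O(U) Hartree tadpole, any δ-function term) does not enter the derivative orders;
* **`twoLeg_scaleZero_sep_moments_of_decomposition`**: for the cell's data — if the K-separated remainder IS the localised two-leg data of
  some Grassmann element `G'`, `klLocSelfEnergyRe … K 0 k⃗ − K(p_k⃗) = loc(G')(k⃗)` (the engine's tree-level / counterterm separation,
  `selfEnergy_sub`), then `m₀ := 2Mˢ₀(G')` (full zeroth moment) and `mₖ := 2Mˢ♯ₖ(G')` (`k = 1, 2`, off-diagonal) are admissible sizes for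
  `twoLegPieceFn_eval_zero_tier1_size_le_sep`.

Proofs only; no definitions; nothing about the model is asserted.  References: BGM 2006 §2.3 (2.17), §2.4 [cite: BenfattoGiulianiMastropietro2006].
-/

noncomputable section

namespace Summit.HubbardSuperconductivity.HubbardSuperconductivity.Theorems.TwoLegFourier

set_option linter.dupNamespace false -- summit = problem name (single-conjunct summit), D-0017

open Finset Complex
open Literature.MathematicalPhysics.QuantumLattice Literature.Probability.LatticeModels GrassmannAlgebra
open Summit.HubbardSuperconductivity.HubbardSuperconductivity.Theorems.KLRegimeSplit

variable {L M : ℕ} [NeZero L]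

/-! ## §1 The bridge for an arbitrary even nonnegative weight -/

/-- **MOMENTS OF THE COSINE COEFFICIENTS OF `k⃗ ↦ Re Σ((ω,k⃗),σ)` FOR ANY EVEN WEIGHT `w ≥ 0`**: if
`ε_x Σ_{x : x 0 = x₀} w(x⃗₁ − x⃗₀) ‖W(x)‖ ≤ M` for every `x₀` (`W` the string's unsectorised position kernel), then
`Σ_y w(y) |torusCosCoeff L (k⃗ ↦ Re Σ((ω,k⃗),σ)) y| ≤ 2·M`. [cite: BenfattoGiulianiMastropietro2006, §2.3 (2.17)] -/
theorem sum_evenWeight_abs_torusCosCoeff_re_selfEnergy_le [NeZero M] {β : ℝ} (hβ : 0 < β) (G : HubbardGrassmann L M)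
    (n : MatsubaraIdx M) (σ : Fin 2) {w : TorusSite 2 L → ℝ} (hw0 : ∀ z, 0 ≤ w z) (hweven : ∀ z, w (-z) = w z) {Ms : ℝ}
    (hMs : ∀ x₀ : SpaceTimeIdx L M, imagTimeWeight β M *
      ∑ x ∈ (univ : Finset (Fin 2 → SpaceTimeIdx L M)).filter (fun x => x 0 = x₀),
        w ((x 1).2 - (x 0).2) *
          ‖sectorisedKernel L M β (trivialMultiplier L M) G 2 (![((0, σ), 0), ((0, σ), 1)] : Fin 2 → SectorLeg 1) x‖ ≤ Ms) :
    ∑ y : TorusSite 2 L, w y * |torusCosCoeff L (fun k => (selfEnergy L M β G (n, k) σ).re) y| ≤ 2 * Ms := by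
  set W := sectorisedKernel L M β (trivialMultiplier L M) G 2 (![((0, σ), 0), ((0, σ), 1)] : Fin 2 → SectorLeg 1) with hW
  set d : (Fin 2 → SpaceTimeIdx L M) → TorusSite 2 L := fun x => (x 1).2 - (x 0).2 with hd
  set P : ℝ := (Fintype.card (SpaceTimeIdx L M) : ℝ) with hP
  have hPpos : 0 < P := by
    rw [hP]; exact_mod_cast (Fintype.card_pos_iff.2 ⟨(n, 0)⟩ : 0 < Fintype.card (SpaceTimeIdx L M))
  have hεpos : 0 < imagTimeWeight β M := by
    unfold imagTimeWeight
    have : (0 : ℝ) < M := by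
      have hM : 0 < 2 * M := n.pos
      exact_mod_cast Nat.pos_of_mul_pos_left hM
    positivity
  have hεP : imagTimeWeight β M * P = β * (L : ℝ) ^ 2 := imagTimeWeight_mul_card β L M
  -- the weighted sum over all tuples, sliced by the pinned leg
  have htot : ∑ x : Fin 2 → SpaceTimeIdx L M, w (d x) * ‖W x‖ ≤ P * (Ms / imagTimeWeight β M) := by
    rw [← sum_fiberwise_of_maps_to (s := univ) (t := (univ : Finset (SpaceTimeIdx L M))) (g := fun x => x 0)
      (fun _ _ => mem_univ _)]
    have hPsum : P * (Ms / imagTimeWeight β M) = ∑ _x₀ : SpaceTimeIdx L M, Ms / imagTimeWeight β M := by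
      rw [sum_const, card_univ, nsmul_eq_mul, hP]
    rw [hPsum]
    refine sum_le_sum fun x₀ _ => ?_
    rw [le_div_iff₀ hεpos, mul_comm]
    exact hMs x₀
  -- the two collapsed sums
  have hN : ∑ y : TorusSite 2 L, w y * (∑ x : Fin 2 → SpaceTimeIdx L M, if y = d x then ‖W x‖ else 0) =
      ∑ x : Fin 2 → SpaceTimeIdx L M, w (d x) * ‖W x‖ := by
    simp_rw [mul_sum, mul_ite, mul_zero]
    rw [sum_comm]
    refine sum_congr rfl fun x _ => ?_
    rw [sum_ite_eq' univ (d x) (fun y => w y * ‖W x‖), if_pos (mem_univ _)]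
  have hN' : ∑ y : TorusSite 2 L, w y * (∑ x : Fin 2 → SpaceTimeIdx L M, if -y = d x then ‖W x‖ else 0) =
      ∑ x : Fin 2 → SpaceTimeIdx L M, w (d x) * ‖W x‖ := by
    simp_rw [mul_sum, mul_ite, mul_zero, neg_eq_iff_eq_neg]
    rw [sum_comm]
    refine sum_congr rfl fun x _ => ?_
    rw [sum_ite_eq' univ (-d x) (fun y => w y * ‖W x‖), if_pos (mem_univ _), hweven]
  -- pointwise bound, summed
  have hpt : ∀ y, w y * |torusCosCoeff L (fun k => (selfEnergy L M β G (n, k) σ).re) y| ≤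
      w y * (β * (L : ℝ) ^ 2 / P ^ 2 * ((∑ x : Fin 2 → SpaceTimeIdx L M, if y = d x then ‖W x‖ else 0) +
        (∑ x : Fin 2 → SpaceTimeIdx L M, if -y = d x then ‖W x‖ else 0))) := fun y =>
    mul_le_mul_of_nonneg_left (abs_torusCosCoeff_re_selfEnergy_le hβ G n σ y) (hw0 y)
  calc ∑ y, w y * |torusCosCoeff L (fun k => (selfEnergy L M β G (n, k) σ).re) y|
      ≤ ∑ y, w y * (β * (L : ℝ) ^ 2 / P ^ 2 * ((∑ x : Fin 2 → SpaceTimeIdx L M, if y = d x then ‖W x‖ else 0) +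
          (∑ x : Fin 2 → SpaceTimeIdx L M, if -y = d x then ‖W x‖ else 0))) := sum_le_sum fun y _ => hpt y
    _ = β * (L : ℝ) ^ 2 / P ^ 2 * ((∑ y : TorusSite 2 L, w y * (∑ x : Fin 2 → SpaceTimeIdx L M, if y = d x then ‖W x‖ else 0)) +
          (∑ y : TorusSite 2 L, w y * (∑ x : Fin 2 → SpaceTimeIdx L M, if -y = d x then ‖W x‖ else 0))) := by
        rw [← sum_add_distrib, mul_sum]
        refine sum_congr rfl fun y _ => ?_
        ring
    _ = β * (L : ℝ) ^ 2 / P ^ 2 * (∑ x : Fin 2 → SpaceTimeIdx L M, w (d x) * ‖W x‖ +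
          ∑ x : Fin 2 → SpaceTimeIdx L M, w (d x) * ‖W x‖) := by rw [hN, hN']
    _ ≤ β * (L : ℝ) ^ 2 / P ^ 2 * (P * (Ms / imagTimeWeight β M) + P * (Ms / imagTimeWeight β M)) := by
        gcongr
    _ = 2 * Ms := by
        rw [← hεP]
        field_simp
        ring

/-! ## §2 The off-diagonal weight and the localised (spin- and `±ω₀`-averaged) data of a generic `G` -/

omit [NeZero L] in
/-- The off-diagonal moment weight `[z ≠ 0]·(1 + |z̃₀| + |z̃₁|)ʲ` is even on the torus. -/
theorem offDiagWeight_neg (j : ℕ) (z : TorusSite 2 L) :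
    (if -z = 0 then (0 : ℝ) else (1 + (((-z) 0).valMinAbs.natAbs : ℝ) + (((-z) 1).valMinAbs.natAbs : ℝ)) ^ j) =
      (if z = 0 then (0 : ℝ) else (1 + ((z 0).valMinAbs.natAbs : ℝ) + ((z 1).valMinAbs.natAbs : ℝ)) ^ j) := by
  simp only [neg_eq_zero, Pi.neg_apply, ZMod.natAbs_valMinAbs_neg]

/-- **OFF-ZERO COEFFICIENT MOMENTS OF THE LOCALISED TWO-LEG DATA OF A GENERIC `G` FROM ITS OFF-DIAGONAL POSITION MOMENTS**: with
`loc(G)(k⃗) = ¼Σ_σ[Re Σ_G((ω₀,k⃗),σ) + Re Σ_G((−ω₀,k⃗),σ)]`, if for both spin strings and every `x₀`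
`ε_x Σ_{x : x 0 = x₀, x⃗₁ ≠ x⃗₀} (1+|Δx̃₀|+|Δx̃₁|)ʲ ‖W_σ(G)(x)‖ ≤ Mˢ♯`, then `Σ_{y ≠ 0} (1+|ỹ₀|+|ỹ₁|)ʲ |loc(G)_c(y)| ≤ 2·Mˢ♯`. -/
theorem sum_offDiag_weight_abs_torusCosCoeff_locRe_le [NeZero M] {β : ℝ} (hβ : 0 < β) (G : HubbardGrassmann L M) (j : ℕ)
    {Ms : ℝ}
    (hMs : ∀ (σ : Fin 2) (x₀ : SpaceTimeIdx L M), imagTimeWeight β M *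
      ∑ x ∈ (univ : Finset (Fin 2 → SpaceTimeIdx L M)).filter (fun x => x 0 = x₀ ∧ (x 1).2 ≠ (x 0).2),
        (1 + ((((x 1).2 - (x 0).2) 0).valMinAbs.natAbs : ℝ) + ((((x 1).2 - (x 0).2) 1).valMinAbs.natAbs : ℝ)) ^ j *
          ‖sectorisedKernel L M β (trivialMultiplier L M) G 2 (![((0, σ), 0), ((0, σ), 1)] : Fin 2 → SectorLeg 1) x‖ ≤ Ms) :
    ∑ y ∈ (univ : Finset (TorusSite 2 L)).filter (fun y => y ≠ 0),
        (1 + ((y 0).valMinAbs.natAbs : ℝ) + ((y 1).valMinAbs.natAbs : ℝ)) ^ j *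
          |torusCosCoeff L (fun k => (∑ σ : Fin 2, ((selfEnergy L M β G (omega0 M, k) σ).re +
            (selfEnergy L M β G ((omega0 M).rev, k) σ).re)) / 4) y| ≤ 2 * Ms := by
  set w : TorusSite 2 L → ℝ := fun z =>
    if z = 0 then (0 : ℝ) else (1 + ((z 0).valMinAbs.natAbs : ℝ) + ((z 1).valMinAbs.natAbs : ℝ)) ^ j with hw
  have hw0 : ∀ z, 0 ≤ w z := fun z => by rw [hw]; dsimp only; split_ifs <;> positivity
  have hweven : ∀ z, w (-z) = w z := fun z => by simp only [hw]; exact offDiagWeight_neg j z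
  -- the hypothesis in the `w`-weighted all-tuples form
  have hMs' : ∀ (σ : Fin 2) (x₀ : SpaceTimeIdx L M), imagTimeWeight β M *
      ∑ x ∈ (univ : Finset (Fin 2 → SpaceTimeIdx L M)).filter (fun x => x 0 = x₀),
        w ((x 1).2 - (x 0).2) *
          ‖sectorisedKernel L M β (trivialMultiplier L M) G 2 (![((0, σ), 0), ((0, σ), 1)] : Fin 2 → SectorLeg 1) x‖ ≤ Ms := by
    intro σ x₀
    have heq : ∑ x ∈ (univ : Finset (Fin 2 → SpaceTimeIdx L M)).filter (fun x => x 0 = x₀),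
        w ((x 1).2 - (x 0).2) *
          ‖sectorisedKernel L M β (trivialMultiplier L M) G 2 (![((0, σ), 0), ((0, σ), 1)] : Fin 2 → SectorLeg 1) x‖ =
        ∑ x ∈ (univ : Finset (Fin 2 → SpaceTimeIdx L M)).filter (fun x => x 0 = x₀ ∧ (x 1).2 ≠ (x 0).2),
        (1 + ((((x 1).2 - (x 0).2) 0).valMinAbs.natAbs : ℝ) + ((((x 1).2 - (x 0).2) 1).valMinAbs.natAbs : ℝ)) ^ j *
          ‖sectorisedKernel L M β (trivialMultiplier L M) G 2 (![((0, σ), 0), ((0, σ), 1)] : Fin 2 → SectorLeg 1) x‖ := by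
      rw [← filter_filter, sum_filter (p := fun x : Fin 2 → SpaceTimeIdx L M => (x 1).2 ≠ (x 0).2)]
      refine sum_congr rfl fun x _ => ?_
      simp only [hw, sub_eq_zero]
      by_cases h : (x 1).2 = (x 0).2
      · rw [if_pos h, if_neg (not_not.2 h), zero_mul]
      · rw [if_neg h, if_pos h]
    rw [heq]
    exact hMs σ x₀
  -- the data as the average of four real parts
  set f : MatsubaraIdx M → Fin 2 → TorusSite 2 L → ℝ := fun m σ k => (selfEnergy L M β G (m, k) σ).re with hf
  have hdata : (fun k => (∑ σ : Fin 2, ((selfEnergy L M β G (omega0 M, k) σ).re +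
      (selfEnergy L M β G ((omega0 M).rev, k) σ).re)) / 4) = fun k => (1 / 4 : ℝ) *
      ((f (omega0 M) 0 k + f (omega0 M).rev 0 k) + (f (omega0 M) 1 k + f (omega0 M).rev 1 k)) := by
    funext k
    simp only [hf, Fin.sum_univ_two]
    ring
  have hcoeff : ∀ y, torusCosCoeff L (fun k => (∑ σ : Fin 2, ((selfEnergy L M β G (omega0 M, k) σ).re +
      (selfEnergy L M β G ((omega0 M).rev, k) σ).re)) / 4) y = (1 / 4 : ℝ) *
      ((torusCosCoeff L (f (omega0 M) 0) y + torusCosCoeff L (f (omega0 M).rev 0) y) +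
        (torusCosCoeff L (f (omega0 M) 1) y + torusCosCoeff L (f (omega0 M).rev 1) y)) := by
    intro y
    rw [hdata, torusCosCoeff_const_mul, torusCosCoeff_add L (fun k => f (omega0 M) 0 k + f (omega0 M).rev 0 k)
      (fun k => f (omega0 M) 1 k + f (omega0 M).rev 1 k), torusCosCoeff_add, torusCosCoeff_add]
  have hb : ∀ (m : MatsubaraIdx M) (σ : Fin 2), ∑ y, w y * |torusCosCoeff L (f m σ) y| ≤ 2 * Ms := fun m σ =>
    sum_evenWeight_abs_torusCosCoeff_re_selfEnergy_le hβ G m σ hw0 hweven (hMs' σ)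
  have hpt : ∀ y, w y * |torusCosCoeff L (fun k => (∑ σ : Fin 2, ((selfEnergy L M β G (omega0 M, k) σ).re +
      (selfEnergy L M β G ((omega0 M).rev, k) σ).re)) / 4) y| ≤ (1 / 4 : ℝ) *
      ((w y * |torusCosCoeff L (f (omega0 M) 0) y| + w y * |torusCosCoeff L (f (omega0 M).rev 0) y|) +
        (w y * |torusCosCoeff L (f (omega0 M) 1) y| + w y * |torusCosCoeff L (f (omega0 M).rev 1) y|)) := by
    intro y
    rw [hcoeff, abs_mul, abs_of_pos (by norm_num : (0 : ℝ) < 1 / 4)]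
    have h1 := abs_add_le (torusCosCoeff L (f (omega0 M) 0) y + torusCosCoeff L (f (omega0 M).rev 0) y)
      (torusCosCoeff L (f (omega0 M) 1) y + torusCosCoeff L (f (omega0 M).rev 1) y)
    have h2 := abs_add_le (torusCosCoeff L (f (omega0 M) 0) y) (torusCosCoeff L (f (omega0 M).rev 0) y)
    have h3 := abs_add_le (torusCosCoeff L (f (omega0 M) 1) y) (torusCosCoeff L (f (omega0 M).rev 1) y)
    have hwy := hw0 y
    nlinarith
  -- the filtered sum is the `w`-weighted full sum
  have hfilt : ∑ y ∈ (univ : Finset (TorusSite 2 L)).filter (fun y => y ≠ 0),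
      (1 + ((y 0).valMinAbs.natAbs : ℝ) + ((y 1).valMinAbs.natAbs : ℝ)) ^ j *
        |torusCosCoeff L (fun k => (∑ σ : Fin 2, ((selfEnergy L M β G (omega0 M, k) σ).re +
          (selfEnergy L M β G ((omega0 M).rev, k) σ).re)) / 4) y| =
      ∑ y, w y * |torusCosCoeff L (fun k => (∑ σ : Fin 2, ((selfEnergy L M β G (omega0 M, k) σ).re +
          (selfEnergy L M β G ((omega0 M).rev, k) σ).re)) / 4) y| := by
    rw [sum_filter]
    refine sum_congr rfl fun y _ => ?_
    simp only [hw]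
    by_cases hy : y = 0
    · rw [if_neg (not_not.2 hy), if_pos hy, zero_mul]
    · rw [if_pos hy, if_neg hy]
  rw [hfilt]
  calc ∑ y, w y * |torusCosCoeff L (fun k => (∑ σ : Fin 2, ((selfEnergy L M β G (omega0 M, k) σ).re +
          (selfEnergy L M β G ((omega0 M).rev, k) σ).re)) / 4) y|
      ≤ ∑ y, (1 / 4 : ℝ) * ((w y * |torusCosCoeff L (f (omega0 M) 0) y| + w y * |torusCosCoeff L (f (omega0 M).rev 0) y|) +
          (w y * |torusCosCoeff L (f (omega0 M) 1) y| + w y * |torusCosCoeff L (f (omega0 M).rev 1) y|)) :=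
        sum_le_sum fun y _ => hpt y
    _ = (1 / 4 : ℝ) * ((∑ y, w y * |torusCosCoeff L (f (omega0 M) 0) y| + ∑ y, w y * |torusCosCoeff L (f (omega0 M).rev 0) y|) +
          (∑ y, w y * |torusCosCoeff L (f (omega0 M) 1) y| + ∑ y, w y * |torusCosCoeff L (f (omega0 M).rev 1) y|)) := by
        rw [← mul_sum, sum_add_distrib, sum_add_distrib, sum_add_distrib]
    _ ≤ (1 / 4 : ℝ) * ((2 * Ms + 2 * Ms) + (2 * Ms + 2 * Ms)) := by
        gcongr
        · exact hb _ _
        · exact hb _ _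
        · exact hb _ _
        · exact hb _ _
    _ = 2 * Ms := by ring

/-- **Derivatives (`k ≥ 1`) of the interpolant of the localised data of a generic `G` from its OFF-DIAGONAL position moments**:
`‖Dᵏ evalM (symInterp L loc(G)) q‖ ≤ 2·Mˢ♯ₖ`. -/
theorem norm_iteratedFDeriv_evalM_symInterp_locRe_le_offDiag [NeZero M] {β : ℝ} (hβ : 0 < β) (G : HubbardGrassmann L M)
    {k : ℕ} (hk : 1 ≤ k) {Ms : ℝ}
    (hMs : ∀ (σ : Fin 2) (x₀ : SpaceTimeIdx L M), imagTimeWeight β M *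
      ∑ x ∈ (univ : Finset (Fin 2 → SpaceTimeIdx L M)).filter (fun x => x 0 = x₀ ∧ (x 1).2 ≠ (x 0).2),
        (1 + ((((x 1).2 - (x 0).2) 0).valMinAbs.natAbs : ℝ) + ((((x 1).2 - (x 0).2) 1).valMinAbs.natAbs : ℝ)) ^ k *
          ‖sectorisedKernel L M β (trivialMultiplier L M) G 2 (![((0, σ), 0), ((0, σ), 1)] : Fin 2 → SectorLeg 1) x‖ ≤ Ms)
    (q : Momentum) :
    ‖iteratedFDeriv ℝ k (evalM (symInterp L (fun p => (∑ σ : Fin 2, ((selfEnergy L M β G (omega0 M, p) σ).re +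
      (selfEnergy L M β G ((omega0 M).rev, p) σ).re)) / 4))) q‖ ≤ 2 * Ms :=
  (norm_iteratedFDeriv_evalM_symInterp_le_offZero_moments L _ hk q).trans (sum_offDiag_weight_abs_torusCosCoeff_locRe_le hβ G k hMs)

/-- **Order `0` of the interpolant of the localised data of a generic `G` from its FULL zeroth position moment**:
`‖D⁰ evalM (symInterp L loc(G)) q‖ ≤ 2·Mˢ₀`. -/
theorem norm_iteratedFDeriv_zero_evalM_symInterp_locRe_le [NeZero M] {β : ℝ} (hβ : 0 < β) (G : HubbardGrassmann L M) {Ms : ℝ}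
    (hMs : ∀ (σ : Fin 2) (x₀ : SpaceTimeIdx L M), imagTimeWeight β M *
      ∑ x ∈ (univ : Finset (Fin 2 → SpaceTimeIdx L M)).filter (fun x => x 0 = x₀),
        (1 + ((((x 1).2 - (x 0).2) 0).valMinAbs.natAbs : ℝ) + ((((x 1).2 - (x 0).2) 1).valMinAbs.natAbs : ℝ)) ^ 0 *
          ‖sectorisedKernel L M β (trivialMultiplier L M) G 2 (![((0, σ), 0), ((0, σ), 1)] : Fin 2 → SectorLeg 1) x‖ ≤ Ms)
    (q : Momentum) :
    ‖iteratedFDeriv ℝ 0 (evalM (symInterp L (fun p => (∑ σ : Fin 2, ((selfEnergy L M β G (omega0 M, p) σ).re +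
      (selfEnergy L M β G ((omega0 M).rev, p) σ).re)) / 4))) q‖ ≤ 2 * Ms := by
  have hw0 : ∀ z : TorusSite 2 L, 0 ≤ (1 + ((z 0).valMinAbs.natAbs : ℝ) + ((z 1).valMinAbs.natAbs : ℝ)) ^ 0 := fun z => by positivity
  have hweven : ∀ z : TorusSite 2 L, (1 + (((-z) 0).valMinAbs.natAbs : ℝ) + (((-z) 1).valMinAbs.natAbs : ℝ)) ^ 0 =
      (1 + ((z 0).valMinAbs.natAbs : ℝ) + ((z 1).valMinAbs.natAbs : ℝ)) ^ 0 := fun z => momentWeight_neg 0 z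
  refine (norm_iteratedFDeriv_zero_evalM_symInterp_le L _ q).trans ?_
  -- average of the four strings, each bounded by the generic even-weight bridge at weight `1`
  set f : MatsubaraIdx M → Fin 2 → TorusSite 2 L → ℝ := fun m σ k => (selfEnergy L M β G (m, k) σ).re with hf
  have hb : ∀ (m : MatsubaraIdx M) (σ : Fin 2), ∑ y, |torusCosCoeff L (f m σ) y| ≤ 2 * Ms := by
    intro m σ
    have h := sum_evenWeight_abs_torusCosCoeff_re_selfEnergy_le hβ G m σ hw0 hweven (hMs σ)
    simpa only [pow_zero, one_mul] using h
  have hcoeff : ∀ y, torusCosCoeff L (fun k => (∑ σ : Fin 2, ((selfEnergy L M β G (omega0 M, k) σ).re +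
      (selfEnergy L M β G ((omega0 M).rev, k) σ).re)) / 4) y = (1 / 4 : ℝ) *
      ((torusCosCoeff L (f (omega0 M) 0) y + torusCosCoeff L (f (omega0 M).rev 0) y) +
        (torusCosCoeff L (f (omega0 M) 1) y + torusCosCoeff L (f (omega0 M).rev 1) y)) := by
    intro y
    have hdata : (fun k => (∑ σ : Fin 2, ((selfEnergy L M β G (omega0 M, k) σ).re +
        (selfEnergy L M β G ((omega0 M).rev, k) σ).re)) / 4) = fun k => (1 / 4 : ℝ) *
        ((f (omega0 M) 0 k + f (omega0 M).rev 0 k) + (f (omega0 M) 1 k + f (omega0 M).rev 1 k)) := by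
      funext k
      simp only [hf, Fin.sum_univ_two]
      ring
    rw [hdata, torusCosCoeff_const_mul, torusCosCoeff_add L (fun k => f (omega0 M) 0 k + f (omega0 M).rev 0 k)
      (fun k => f (omega0 M) 1 k + f (omega0 M).rev 1 k), torusCosCoeff_add, torusCosCoeff_add]
  have hpt : ∀ y, |torusCosCoeff L (fun k => (∑ σ : Fin 2, ((selfEnergy L M β G (omega0 M, k) σ).re +
      (selfEnergy L M β G ((omega0 M).rev, k) σ).re)) / 4) y| ≤ (1 / 4 : ℝ) *
      ((|torusCosCoeff L (f (omega0 M) 0) y| + |torusCosCoeff L (f (omega0 M).rev 0) y|) +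
        (|torusCosCoeff L (f (omega0 M) 1) y| + |torusCosCoeff L (f (omega0 M).rev 1) y|)) := by
    intro y
    rw [hcoeff, abs_mul, abs_of_pos (by norm_num : (0 : ℝ) < 1 / 4)]
    gcongr
    refine (abs_add_le _ _).trans (add_le_add (abs_add_le _ _) (abs_add_le _ _))
  calc ∑ y, |torusCosCoeff L (fun k => (∑ σ : Fin 2, ((selfEnergy L M β G (omega0 M, k) σ).re +
          (selfEnergy L M β G ((omega0 M).rev, k) σ).re)) / 4) y|
      ≤ ∑ y, (1 / 4 : ℝ) * ((|torusCosCoeff L (f (omega0 M) 0) y| + |torusCosCoeff L (f (omega0 M).rev 0) y|) +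
          (|torusCosCoeff L (f (omega0 M) 1) y| + |torusCosCoeff L (f (omega0 M).rev 1) y|)) := sum_le_sum fun y _ => hpt y
    _ = (1 / 4 : ℝ) * ((∑ y, |torusCosCoeff L (f (omega0 M) 0) y| + ∑ y, |torusCosCoeff L (f (omega0 M).rev 0) y|) +
          (∑ y, |torusCosCoeff L (f (omega0 M) 1) y| + ∑ y, |torusCosCoeff L (f (omega0 M).rev 1) y|)) := by
        rw [← mul_sum, sum_add_distrib, sum_add_distrib, sum_add_distrib]
    _ ≤ (1 / 4 : ℝ) * ((2 * Ms + 2 * Ms) + (2 * Ms + 2 * Ms)) := by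
        gcongr
        · exact hb _ _
        · exact hb _ _
        · exact hb _ _
        · exact hb _ _
    _ = 2 * Ms := by ring

/-! ## §3 The cell's K-separated scale-`0` data under a decomposition hypothesis -/

section Model

variable [NeZero M]

/-- **ADMISSIBLE SIZES `m₀, m₁, m₂` FOR `twoLegPieceFn_eval_zero_tier1_size_le_sep` FROM A GRASSMANN DECOMPOSITION.**  If the K-separated
scale-`0` localised data is the localised data of a Grassmann element `G'`
(`klLocSelfEnergyRe … K 0 k⃗ − K(p_k⃗) = ¼Σ_σ[Re Σ_{G'}((ω₀,k⃗),σ) + Re Σ_{G'}((−ω₀,k⃗),σ)]`, e.g. `G' = 𝒱^{(0)} −` its tree-level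
counterterm part, by `selfEnergy_sub`), and `G'`'s unsectorised two-leg kernels have full pinned zeroth moment `≤ Mˢ₀` and OFF-DIAGONAL
pinned moments `≤ Mˢ♯ₖ` (`k = 1, 2`), then for every `k ≤ 2` and `q`:
`‖Dᵏ evalM (symInterp L (klLocSelfEnergyRe … K 0 − K∘p)) q‖ ≤ 2·(if k = 0 then Mˢ₀ else Mˢ♯ₖ)`. -/
theorem twoLeg_scaleZero_sep_moments_of_decomposition {β : ℝ} (hβ : 0 < β) (U μ : ℝ) (K : TrigPolyC4v)
    (G' : HubbardGrassmann L M)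
    (hdec : ∀ k : TorusSite 2 L, klLocSelfEnergyRe L M β U μ K 0 k - K.eval (latticeMomentum L k) =
      (∑ σ : Fin 2, ((selfEnergy L M β G' (omega0 M, k) σ).re + (selfEnergy L M β G' ((omega0 M).rev, k) σ).re)) / 4)
    {Ms0 : ℝ} {Msh : ℕ → ℝ}
    (hMs0 : ∀ (σ : Fin 2) (x₀ : SpaceTimeIdx L M), imagTimeWeight β M *
      ∑ x ∈ (univ : Finset (Fin 2 → SpaceTimeIdx L M)).filter (fun x => x 0 = x₀),
        (1 + ((((x 1).2 - (x 0).2) 0).valMinAbs.natAbs : ℝ) + ((((x 1).2 - (x 0).2) 1).valMinAbs.natAbs : ℝ)) ^ 0 *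
          ‖sectorisedKernel L M β (trivialMultiplier L M) G' 2 (![((0, σ), 0), ((0, σ), 1)] : Fin 2 → SectorLeg 1) x‖ ≤ Ms0)
    (hMsh : ∀ k, 1 ≤ k → k ≤ 2 → ∀ (σ : Fin 2) (x₀ : SpaceTimeIdx L M), imagTimeWeight β M *
      ∑ x ∈ (univ : Finset (Fin 2 → SpaceTimeIdx L M)).filter (fun x => x 0 = x₀ ∧ (x 1).2 ≠ (x 0).2),
        (1 + ((((x 1).2 - (x 0).2) 0).valMinAbs.natAbs : ℝ) + ((((x 1).2 - (x 0).2) 1).valMinAbs.natAbs : ℝ)) ^ k *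
          ‖sectorisedKernel L M β (trivialMultiplier L M) G' 2 (![((0, σ), 0), ((0, σ), 1)] : Fin 2 → SectorLeg 1) x‖ ≤ Msh k) :
    ∀ k ≤ 2, ∀ q : Momentum, ‖iteratedFDeriv ℝ k
      (evalM (symInterp L (fun p => klLocSelfEnergyRe L M β U μ K 0 p - K.eval (latticeMomentum L p)))) q‖ ≤
        2 * (if k = 0 then Ms0 else Msh k) := by
  intro k hk q
  have hfun : (fun p => klLocSelfEnergyRe L M β U μ K 0 p - K.eval (latticeMomentum L p)) =
      fun p => (∑ σ : Fin 2, ((selfEnergy L M β G' (omega0 M, p) σ).re + (selfEnergy L M β G' ((omega0 M).rev, p) σ).re)) / 4 :=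
    funext hdec
  rw [hfun]
  rcases Nat.eq_zero_or_pos k with rfl | hkpos
  · rw [if_pos rfl]
    exact norm_iteratedFDeriv_zero_evalM_symInterp_locRe_le hβ G' hMs0 q
  · rw [if_neg (by omega)]
    exact norm_iteratedFDeriv_evalM_symInterp_locRe_le_offDiag hβ G' hkpos (hMsh k hkpos hk) q

end Model

end Summit.HubbardSuperconductivity.HubbardSuperconductivity.Theorems.TwoLegFourier

end
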